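import Mathlib

/-!
# Crux `RankDefectRepresentations` (stmt-PneNP-18923), line `rank-dehn-ladder`, negative rung N0b:
# the MERGE step is not absolute-constant (lead g8)

The only generator-by-generator schemes that could reach a POLYNOMIAL modulus in `stub_uniformStability`
(N0b) are divide-and-conquer schemes whose merge step — "two EXACT commuting idempotent families whose cross
commutators have rank `≤ s` are jointly within rank `C · s` of a commuting family" — has an ABSOLUTE constant
`C` (lead g7, `Lines/rank-dehn-ladder-g7-final.md` §3, sub-target MERGE).  This file refutes that merge
statement: for every `k` there are two exact commuting idempotent families `E_0..E_{k-1}`, `F_0..F_{k-1}`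
(on `K^k ⊗ K^k ⊗ K^2`: `E_i = P_i ⊗ 1 ⊗ D`, `F_j = 1 ⊗ P_j ⊗ H` with `D`, `H` rank-one idempotents of `K²`
whose commutator is invertible) such that every cross commutator `[E_i, F_j]` has rank `≤ 2`, while for EVERY
pair of families `E'`, `F'` with `E'_i F'_j = F'_j E'_i` (no idempotency or internal commutation needed)
`k² ≤ Σ_i rank (E_i - E'_i) + Σ_j rank (F_j - F'_j)`; hence some generator moves by `≥ k/2`
(`merge_lower_bound`, `exists_far_generator`).  Proof: `T = Σ_i E_i = 1 ⊗ 1 ⊗ D` and `U = Σ_j F_j = 1 ⊗ 1 ⊗ H`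
have the INVERTIBLE commutator `1 ⊗ 1 ⊗ [D,H]` (rank `2k²`), and `[T,U] = (T-T')U + T'(U-U') - U(T-T') - (U-U')T'`
for any `T' = Σ E'`, `U' = Σ F'` with `[T',U'] = 0`.  Consequence for the line: every two-family merge theorem
costs `≥ min(k,m) · s / 4`, so no recursion over subsets of generators (sequential, balanced or unbalanced)
reaches a polynomial modulus from merge bounds alone; a proof of N0b must use the common origin of the two
halves.  (The instance is the all-pairs gadget sum behind `stub_linearInstability`, read as a merge problem.)
HONEST FRAMING: elementary linear algebra; P ≠ NP is not moved; F-N2 is a FRONTIER formal rung.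
-/

set_option linter.dupNamespace false -- `Summit.PneNP.PneNP.…`: summit = sub-problem name (D-0017)

namespace Summit.PneNP.PneNP.Theorems.CnfIdealGenLengthRankDefectRepresentationsMergeLowerBound

open Matrix
open scoped Kronecker

variable {K : Type} [Field K]

section Tools

/-- `rank (A + B) ≤ rank A + rank B`. [folklore] -/
theorem rank_add_le' {m n : Type} [Fintype m] [Fintype n] (A B : Matrix m n K) :
    (A + B).rank ≤ A.rank + B.rank := by
  unfold Matrix.rank
  rw [Matrix.mulVecLin_add]
  exact (Submodule.finrank_mono (LinearMap.range_add_le _ _)).trans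
    (Submodule.finrank_add_le_finrank_add_finrank _ _)

/-- `rank (-A) = rank A`. [folklore] -/
theorem rank_neg' {m n : Type} [Fintype m] [Fintype n] [DecidableEq m] (A : Matrix m n K) :
    (-A).rank = A.rank := by
  have h : -A = (-1 : Matrix m m K) * A := by rw [Matrix.neg_mul, Matrix.one_mul]
  rw [h, Matrix.rank_mul_eq_right_of_isUnit_det]
  rw [Matrix.det_neg, Matrix.det_one, mul_one]
  exact (isUnit_one.neg).pow _

/-- `rank (A - B) ≤ rank A + rank B`. [folklore] -/
theorem rank_sub_le' {m n : Type} [Fintype m] [Fintype n] [DecidableEq m] (A B : Matrix m n K) :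
    (A - B).rank ≤ A.rank + B.rank := by
  rw [sub_eq_add_neg]
  exact (rank_add_le' A (-B)).trans (by rw [rank_neg'])

/-- Rank of a finite sum is at most the sum of the ranks. [folklore] -/
theorem rank_sum_le' {m n α : Type} [Fintype m] [Fintype n] (s : Finset α) (A : α → Matrix m n K) :
    (∑ i ∈ s, A i).rank ≤ ∑ i ∈ s, (A i).rank := by
  classical
  induction s using Finset.induction_on with
  | empty => simp
  | insert a s ha ih =>
      rw [Finset.sum_insert ha, Finset.sum_insert ha]
      exact (rank_add_le' _ _).trans (Nat.add_le_add_left ih _)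

/-- Kronecker product is additive on the left over finite sums. [folklore] -/
theorem sum_kronecker {l m n p α : Type} (s : Finset α) (A : α → Matrix l m K) (B : Matrix n p K) :
    (∑ i ∈ s, A i) ⊗ₖ B = ∑ i ∈ s, A i ⊗ₖ B := by
  ext ⟨a, b⟩ ⟨c, d⟩
  simp [Matrix.sum_apply, Finset.sum_mul]

/-- Kronecker product is additive on the right over finite sums. [folklore] -/
theorem kronecker_sum {l m n p α : Type} (s : Finset α) (A : Matrix l m K) (B : α → Matrix n p K) :
    A ⊗ₖ (∑ i ∈ s, B i) = ∑ i ∈ s, A ⊗ₖ B i := by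
  ext ⟨a, b⟩ ⟨c, d⟩
  simp [Matrix.sum_apply, Finset.mul_sum]

/-- Kronecker product distributes over subtraction on the right. [folklore] -/
theorem kronecker_sub {l m n p : Type} (A : Matrix l m K) (B C : Matrix n p K) :
    A ⊗ₖ (B - C) = A ⊗ₖ B - A ⊗ₖ C := by
  ext ⟨a, b⟩ ⟨c, d⟩
  simp [mul_sub]

/-- The diagonal matrix units sum to the identity. [folklore] -/
theorem sum_single_diag_eq_one (k : ℕ) :
    ∑ i : Fin k, (Matrix.single i i (1 : K)) = 1 := by
  ext a b
  simp only [Matrix.sum_apply, Matrix.single_apply, Matrix.one_apply]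
  by_cases hab : a = b
  · subst hab; simp
  · rw [if_neg hab]
    refine Finset.sum_eq_zero fun i _ => ?_
    rw [if_neg]
    rintro ⟨rfl, h⟩
    exact hab h

end Tools

section Instance

/-- The rank-one idempotent `D = diag(1,0)` of `K²`. -/
def D : Matrix (Fin 2) (Fin 2) K := !![1, 0; 0, 0]

/-- The rank-one idempotent `H = (1,1)ᵀ(-1,2)` of `K²`; `[D,H]` is invertible when `2 ≠ 0`. -/
def H : Matrix (Fin 2) (Fin 2) K := !![-1, 2; -1, 2]

/-- `D` is idempotent. -/
theorem D_mul_D : (D : Matrix (Fin 2) (Fin 2) K) * D = D := by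
  ext i j; fin_cases i <;> fin_cases j <;> simp [D]

/-- `H` is idempotent. -/
theorem H_mul_H : (H : Matrix (Fin 2) (Fin 2) K) * H = H := by
  ext i j; fin_cases i <;> fin_cases j <;> simp [H] <;> norm_num

/-- The commutator `[D,H] = !![0,2;1,0]`. -/
theorem D_comm_H : (D : Matrix (Fin 2) (Fin 2) K) * H - H * D = !![0, 2; 1, 0] := by
  ext i j; fin_cases i <;> fin_cases j <;> simp [D, H]

/-- The index type `[k] × ([k] × [2])` of `K^k ⊗ K^k ⊗ K²`. -/
abbrev Idx (k : ℕ) : Type := Fin k × (Fin k × Fin 2)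

/-- First exact family: `E_i = P_i ⊗ 1 ⊗ D`. -/
def gadE (k : ℕ) (i : Fin k) : Matrix (Idx k) (Idx k) K :=
  Matrix.single i i (1 : K) ⊗ₖ ((1 : Matrix (Fin k) (Fin k) K) ⊗ₖ D)

/-- Second exact family: `F_j = 1 ⊗ P_j ⊗ H`. -/
def gadF (k : ℕ) (j : Fin k) : Matrix (Idx k) (Idx k) K :=
  (1 : Matrix (Fin k) (Fin k) K) ⊗ₖ (Matrix.single j j (1 : K) ⊗ₖ H)

variable (k : ℕ)

/-- Each `E_i` is idempotent. -/
theorem gadE_idem (i : Fin k) : gadE (K := K) k i * gadE k i = gadE k i := by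
  simp only [gadE, ← Matrix.mul_kronecker_mul, D_mul_D, Matrix.single_mul_single_same, mul_one]

/-- The `E_i` pairwise commute (indeed `E_i E_j = 0` for `i ≠ j`). -/
theorem gadE_comm (i j : Fin k) : gadE (K := K) k i * gadE k j = gadE k j * gadE k i := by
  by_cases hij : i = j
  · subst hij; rfl
  · have h0 : Matrix.single i i (1 : K) * Matrix.single j j (1 : K) = 0 :=
      Matrix.single_mul_single_of_ne (1 : K) i i j hij 1
    have h0' : Matrix.single j j (1 : K) * Matrix.single i i (1 : K) = 0 :=
      Matrix.single_mul_single_of_ne (1 : K) j j i (Ne.symm hij) 1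
    simp only [gadE, ← Matrix.mul_kronecker_mul, h0, h0', Matrix.zero_kronecker]

/-- Each `F_j` is idempotent. -/
theorem gadF_idem (j : Fin k) : gadF (K := K) k j * gadF k j = gadF k j := by
  simp only [gadF, ← Matrix.mul_kronecker_mul, H_mul_H, Matrix.single_mul_single_same, mul_one]

/-- The `F_j` pairwise commute. -/
theorem gadF_comm (i j : Fin k) : gadF (K := K) k i * gadF k j = gadF k j * gadF k i := by
  by_cases hij : i = j
  · subst hij; rfl
  · have h0 : Matrix.single i i (1 : K) * Matrix.single j j (1 : K) = 0 :=
      Matrix.single_mul_single_of_ne (1 : K) i i j hij 1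
    have h0' : Matrix.single j j (1 : K) * Matrix.single i i (1 : K) = 0 :=
      Matrix.single_mul_single_of_ne (1 : K) j j i (Ne.symm hij) 1
    simp only [gadF, ← Matrix.mul_kronecker_mul, h0, h0', Matrix.zero_kronecker, Matrix.kronecker_zero]

/-- Cross commutators: `[E_i, F_j] = P_i ⊗ P_j ⊗ [D,H]`. -/
theorem gadE_gadF_comm_eq (i j : Fin k) :
    gadE (K := K) k i * gadF k j - gadF k j * gadE k i =
      Matrix.single i i (1 : K) ⊗ₖ (Matrix.single j j (1 : K) ⊗ₖ (D * H - H * D)) := by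
  simp only [gadE, gadF, ← Matrix.mul_kronecker_mul, Matrix.one_mul, Matrix.mul_one, kronecker_sub]

/-- Every cross commutator has rank `≤ 2` (it is supported on the two rows `(i, j, ·)`). -/
theorem rank_cross_le (i j : Fin k) : (gadE (K := K) k i * gadF k j - gadF k j * gadE k i).rank ≤ 2 := by
  classical
  rw [gadE_gadF_comm_eq]
  set X : Matrix (Idx k) (Idx k) K :=
    Matrix.single i i (1 : K) ⊗ₖ (Matrix.single j j (1 : K) ⊗ₖ (D * H - H * D)) with hX
  -- factor through the two rows `(i, j, x)`
  set Y : Matrix (Idx k) (Fin 2) K :=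
    Matrix.of fun p y => if i = p.1 ∧ j = p.2.1 ∧ p.2.2 = y then (1 : K) else 0 with hY
  set Z : Matrix (Fin 2) (Idx k) K := Matrix.of fun x q => X (i, j, x) q with hZ
  have hfac : X = Y * Z := by
    ext ⟨a, b, x⟩ ⟨a', b', x'⟩
    have hsum : (Y * Z) (a, b, x) (a', b', x') =
        if i = a ∧ j = b then X (i, j, x) (a', b', x') else 0 := by
      simp only [Matrix.mul_apply, hY, hZ, Matrix.of_apply]
      rw [Finset.sum_eq_single x]
      · by_cases h : i = a ∧ j = b
        · simp [h]
        · simp [h]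
      · intro y _ hy; simp [Ne.symm hy]
      · simp
    rw [hsum, hX]
    simp only [Matrix.kronecker_apply, Matrix.single_apply]
    by_cases ha : i = a <;> by_cases hb : j = b <;> simp [ha, hb]
  rw [hfac]
  exact (Matrix.rank_mul_le_right Y Z).trans ((Matrix.rank_le_card_height Z).trans (by simp))

/-- `Σ_i E_i = 1 ⊗ 1 ⊗ D`. -/
theorem sum_gadE : ∑ i : Fin k, gadE (K := K) k i = (1 : Matrix (Fin k) (Fin k) K) ⊗ₖ ((1 : Matrix (Fin k) (Fin k) K) ⊗ₖ D) := by
  simp only [gadE, ← sum_kronecker, sum_single_diag_eq_one]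

/-- `Σ_j F_j = 1 ⊗ 1 ⊗ H`. -/
theorem sum_gadF : ∑ j : Fin k, gadF (K := K) k j = (1 : Matrix (Fin k) (Fin k) K) ⊗ₖ ((1 : Matrix (Fin k) (Fin k) K) ⊗ₖ H) := by
  simp only [gadF, ← sum_kronecker, ← kronecker_sum, sum_single_diag_eq_one]

/-- The commutator of the two sums is `1 ⊗ 1 ⊗ [D,H]`, an invertible matrix when `2 ≠ 0`. -/
theorem sum_comm_eq :
    (∑ i : Fin k, gadE (K := K) k i) * (∑ j : Fin k, gadF k j) - (∑ j : Fin k, gadF k j) * (∑ i : Fin k, gadE k i)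
      = (1 : Matrix (Fin k) (Fin k) K) ⊗ₖ ((1 : Matrix (Fin k) (Fin k) K) ⊗ₖ (D * H - H * D)) := by
  rw [sum_gadE, sum_gadF]
  simp only [← Matrix.mul_kronecker_mul, Matrix.one_mul, kronecker_sub]

/-- In characteristic `≠ 2` the commutator of the sums has full rank `2k²`. -/
theorem rank_sum_comm [CharZero K] :
    ((∑ i : Fin k, gadE (K := K) k i) * (∑ j : Fin k, gadF k j)
      - (∑ j : Fin k, gadF k j) * (∑ i : Fin k, gadE k i)).rank = k * (k * 2) := by
  classical
  rw [sum_comm_eq, D_comm_H]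
  have hdet : IsUnit (Matrix.det ((1 : Matrix (Fin k) (Fin k) K) ⊗ₖ
      ((1 : Matrix (Fin k) (Fin k) K) ⊗ₖ (!![0, 2; 1, 0] : Matrix (Fin 2) (Fin 2) K)))) := by
    rw [Matrix.det_kronecker, Matrix.det_kronecker, Matrix.det_one, Matrix.det_fin_two_of]
    simp only [one_pow, one_mul]
    exact isUnit_iff_ne_zero.mpr (pow_ne_zero _ (pow_ne_zero _ (by norm_num)))
  rw [Matrix.rank_of_isUnit _ ((Matrix.isUnit_iff_isUnit_det _).mpr hdet)]
  simp [Fintype.card_prod]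

end Instance

section Main

variable (k : ℕ)

/-- **MERGE lower bound (sum form).**  For ANY two families `E'`, `F'` whose members cross-commute
(`E'_i F'_j = F'_j E'_i`), the total rank moved away from the gadget families is at least `k²`:
`k² ≤ Σ_i rank (E_i - E'_i) + Σ_j rank (F_j - F'_j)` — although every cross commutator `[E_i,F_j]`
has rank `≤ 2` and each family is an exact commuting idempotent family. -/
theorem merge_lower_bound [CharZero K] (E' F' : Fin k → Matrix (Idx k) (Idx k) K)
    (hcomm : ∀ i j, E' i * F' j = F' j * E' i) :
    k * k ≤ ∑ i, (gadE k i - E' i).rank + ∑ j, (gadF k j - F' j).rank := by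
  classical
  set T : Matrix (Idx k) (Idx k) K := ∑ i, gadE k i with hT
  set U : Matrix (Idx k) (Idx k) K := ∑ j, gadF k j with hU
  set T' : Matrix (Idx k) (Idx k) K := ∑ i, E' i with hT'
  set U' : Matrix (Idx k) (Idx k) K := ∑ j, F' j with hU'
  have hTU' : T' * U' = U' * T' := by
    simp only [hT', hU', Finset.sum_mul, Finset.mul_sum]
    rw [Finset.sum_comm]
    exact Finset.sum_congr rfl fun _ _ => Finset.sum_congr rfl fun _ _ => hcomm _ _
  have hid : T * U - U * T = (T - T') * U + T' * (U - U') - U * (T - T') - (U - U') * T' := by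
    have : T' * U' - U' * T' = 0 := sub_eq_zero.mpr hTU'
    rw [sub_mul, mul_sub, mul_sub, sub_mul]
    abel_nf
    rw [← sub_eq_zero]; rw [← this]; abel
  have hrank : (T * U - U * T).rank = k * (k * 2) := by rw [hT, hU]; exact rank_sum_comm k
  have hTT : (T - T').rank ≤ ∑ i, (gadE k i - E' i).rank := by
    rw [hT, hT', ← Finset.sum_sub_distrib]; exact rank_sum_le' _ _
  have hUU : (U - U').rank ≤ ∑ j, (gadF k j - F' j).rank := by
    rw [hU, hU', ← Finset.sum_sub_distrib]; exact rank_sum_le' _ _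
  have h1 : ((T - T') * U).rank ≤ (T - T').rank := Matrix.rank_mul_le_left _ _
  have h2 : (T' * (U - U')).rank ≤ (U - U').rank := Matrix.rank_mul_le_right _ _
  have h3 : (U * (T - T')).rank ≤ (T - T').rank := Matrix.rank_mul_le_right _ _
  have h4 : ((U - U') * T').rank ≤ (U - U').rank := Matrix.rank_mul_le_left _ _
  have hle : (T * U - U * T).rank ≤ 2 * (T - T').rank + 2 * (U - U').rank := by
    rw [hid]
    calc ((T - T') * U + T' * (U - U') - U * (T - T') - (U - U') * T').rank
        ≤ ((T - T') * U + T' * (U - U') - U * (T - T')).rank + ((U - U') * T').rank := rank_sub_le' _ _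
      _ ≤ (((T - T') * U + T' * (U - U')).rank + (U * (T - T')).rank) + ((U - U') * T').rank := by
          gcongr; exact rank_sub_le' _ _
      _ ≤ ((((T - T') * U).rank + (T' * (U - U')).rank) + (U * (T - T')).rank) + ((U - U') * T').rank := by
          gcongr; exact rank_add_le' _ _
      _ ≤ 2 * (T - T').rank + 2 * (U - U').rank := by omega
  rw [hrank] at hle
  have : k * k ≤ (T - T').rank + (U - U').rank := by nlinarith
  exact this.trans (Nat.add_le_add hTT hUU)

/-- **MERGE lower bound (max form).**  For `k ≥ 1`: some generator of one of the two exact families must move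
by rank `≥ k/2` in ANY cross-commuting pair of families — in particular in any jointly commuting idempotent
family —, while all cross commutators have rank `≤ 2`: the merge constant is `≥ k/4`, not absolute. -/
theorem exists_far_generator [CharZero K] (hk : 0 < k) (E' F' : Fin k → Matrix (Idx k) (Idx k) K)
    (hcomm : ∀ i j, E' i * F' j = F' j * E' i) :
    ∃ i j, k ≤ (gadE k i - E' i).rank + (gadF k j - F' j).rank := by
  classical
  have h := merge_lower_bound k E' F' hcomm
  obtain ⟨i₀, -, hi₀⟩ := Finset.exists_max_image Finset.univ (fun i => (gadE (K := K) k i - E' i).rank)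
    ⟨⟨0, hk⟩, Finset.mem_univ _⟩
  obtain ⟨j₀, -, hj₀⟩ := Finset.exists_max_image Finset.univ (fun j => (gadF (K := K) k j - F' j).rank)
    ⟨⟨0, hk⟩, Finset.mem_univ _⟩
  refine ⟨i₀, j₀, ?_⟩
  have hs1 : ∑ i, (gadE k i - E' i).rank ≤ k * (gadE k i₀ - E' i₀).rank := by
    have h1 := Finset.sum_le_sum (s := Finset.univ) (f := fun i => (gadE k i - E' i).rank)
      (g := fun _ => (gadE k i₀ - E' i₀).rank) fun i _ => hi₀ i (Finset.mem_univ _)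
    simpa using h1
  have hs2 : ∑ j, (gadF k j - F' j).rank ≤ k * (gadF k j₀ - F' j₀).rank := by
    have h2 := Finset.sum_le_sum (s := Finset.univ) (f := fun j => (gadF k j - F' j).rank)
      (g := fun _ => (gadF k j₀ - F' j₀).rank) fun j _ => hj₀ j (Finset.mem_univ _)
    simpa using h2
  have : k * k ≤ k * ((gadE k i₀ - E' i₀).rank + (gadF k j₀ - F' j₀).rank) := by
    rw [mul_add]; exact h.trans (Nat.add_le_add hs1 hs2)
  exact Nat.le_of_mul_le_mul_left this hk

/-- **Packaged statement (the refutation of absolute-constant MERGE).**  For every `k ≥ 1` and every field of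
characteristic `0` there are two exact commuting idempotent families of size `k` with all cross commutators
of rank `≤ 2` such that every cross-commuting modification moves some generator by rank `≥ k/2`. -/
theorem merge_not_absolute (K : Type) [Field K] [CharZero K] (k : ℕ) (hk : 0 < k) :
    ∃ (ι : Type) (_ : Fintype ι) (_ : DecidableEq ι) (E F : Fin k → Matrix ι ι K),
      (∀ i, E i * E i = E i) ∧ (∀ i j, E i * E j = E j * E i) ∧
      (∀ j, F j * F j = F j) ∧ (∀ i j, F i * F j = F j * F i) ∧
      (∀ i j, (E i * F j - F j * E i).rank ≤ 2) ∧
      ∀ E' F' : Fin k → Matrix ι ι K, (∀ i j, E' i * F' j = F' j * E' i) →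
        ∃ i j, k ≤ (E i - E' i).rank + (F j - F' j).rank :=
  ⟨Idx k, inferInstance, inferInstance, gadE k, gadF k, gadE_idem k, gadE_comm k, gadF_idem k, gadF_comm k,
    rank_cross_le k, fun E' F' h => exists_far_generator k hk E' F' h⟩

end Main

end Summit.PneNP.PneNP.Theorems.CnfIdealGenLengthRankDefectRepresentationsMergeLowerBound
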